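import Literature.NumberTheory.EllipticCurves.WeierstrassZetaDivisionValuesRows
import HarnessLib

/-!
# Corrected `ζ`-division values at `i∞`: the `q_N`-expansion, constant term, limits,
# boundedness and holomorphy

Topic `Literature/NumberTheory/EllipticCurves`; namespace
`Literature.NumberTheory.EllipticCurves.ModularForms`.  Definitions with bodies (`zetaRowConst`,
`eisensteinOneDivConst`, `eisensteinOneDivCoeff`, `eisensteinOneDivExp`) and theorems; no named
fact.

By `WeierstrassZetaDivisionValuesRows`, for `v ≢ 0 (mod N)` the corrected `ζ`-division value is
`Z_v(τ) = 2πi c_v/N + ∑_m T_m(τ)` with the rows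
`T_m = π cot(π w_m) + [m ≠ 0] π cot(π m τ)`, `w_m = (c_m τ + d_v)/N`, `c_m = c_v - Nm`.  Expanding
the cotangents (`π cot(πw) = -πi - 2πi ∑_{r ≥ 1} e^{2πirw}` for `Im w > 0`, and the odd symmetry
for `Im w < 0`) gives an ABSOLUTELY convergent expansion in monomials `q_N^j = e^{2πijτ/N}`
(`hasSum_eisensteinOneDiv_monomials`):

  `Z_v(τ) = C_v - ∑_{m : c_m ≠ 0} sgn(c_m) 2πi ∑_{r ≥ 1} ζ_N^{sgn(c_m) r d_v} q_N^{r|c_m|}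
              - ∑_{m ≠ 0} sgn(m) 2πi ∑_{r ≥ 1} q_N^{rN|m|}`,

with the **constant term** `C_v = 2πi c_v/N + ∑_m κ_m` (`eisensteinOneDivConst`; the row constants
`κ_m = [c_m = 0] π cot(π d_v/N) - [c_m ≠ 0] sgn(c_m) πi - [m ≠ 0] sgn(m) πi` are finitely
supported), whose value in the fundamental range is

* `eisensteinOneDivConst_eq_of_pos_of_lt` — **`C_v = 2πi (c_v/N - 1/2) = 2πi B₁(c_v/N)`** for
  `0 < c_v < N`;
* `eisensteinOneDivConst_eq_of_eq_zero` — **`C_v = π cot(π d_v/N)`** for `c_v = 0`, `N ∤ d_v`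

(the first periodic Bernoulli function and the cotangent values that give `B_{1,ψ}`, `L(1, ψ)` in the
constant terms of the weight-one Eisenstein series with character; Hecke 1927, (13);
Schoeneberg VIII §1; Diamond–Shurman §4.8).  Consequences, for EVERY `v` (`Z_v = 0` when
`v ≡ 0`):

* `tendsto_eisensteinOneDiv_atImInfty` — `Z_v(τ) → C_v` as `Im τ → ∞` (Tannery);
* `isBoundedAtImInfty_eisensteinOneDiv` — `Z_v` is bounded at `i∞` (hence at every cusp, by
  `Z_v ∣₁ γ = Z_{vγ}`);
* `mdifferentiable_eisensteinOneDiv` — `Z_v` is holomorphic on `ℍ`;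
* `eisensteinOneDivConst_add_nsmul` — `C_{v + Nw} = C_v`.

All coefficients of the expansion other than `C_v` are `2πi` times roots of unity; this is the
integrality of the weight-one Eisenstein series assembled from the `Z_v` (next file).

## References

* E. Hecke, *Theorie der Eisensteinschen Reihen höherer Stufe…*, Abh. Math. Sem. Hamburg 5 (1927),
  §2.
* B. Schoeneberg, *Elliptic Modular Functions*, Springer (1974), Ch. VII §2, Ch. VIII §1.
* F. Diamond, J. Shurman, *A First Course in Modular Forms*, GTM 228 (2005), §4.8.
  [DiamondShurman2005]
-/

noncomputable section

open UpperHalfPlane hiding I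
open EisensteinSeries Complex Filter Function

open scoped Real MatrixGroups Topology Manifold

namespace Literature.NumberTheory.EllipticCurves.ModularForms

/-! ### The constant term and the coefficients -/

/-- The **row constant** `κ_m = [c_m = 0] π cot(π d_v/N) - [c_m ≠ 0] sgn(c_m) πi - [m ≠ 0] sgn(m) πi`
(`c_m = c_v - Nm`): the constant term of `T_m = π cot(π w_m) + [m ≠ 0] π cot(π mτ)` at `i∞`.
[cite: DiamondShurman2005, §4.8] -/
def zetaRowConst (N : ℕ) (v : Fin 2 → ℤ) (m : ℤ) : ℂ :=
  (if v 0 - N * m = 0 then π * Complex.cot (π * ((v 1 : ℂ) / N))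
    else -(((v 0 - N * m).sign : ℤ) : ℂ) * (π * I)) +
    (if m = 0 then 0 else -((m.sign : ℤ) : ℂ) * (π * I))

/-- The **constant term** `C_v = 2πi c_v/N + ∑_m κ_m` of `Z_v` at `i∞` (`0` for `v ≡ 0 (mod N)`,
where `Z_v = 0`). [cite: DiamondShurman2005, §4.8] -/
def eisensteinOneDivConst (N : ℕ) (v : Fin 2 → ℤ) : ℂ :=
  if (N : ℤ) ∣ v 0 ∧ (N : ℤ) ∣ v 1 then 0 else
    2 * π * I * (v 0 : ℂ) / N + ∑' m : ℤ, zetaRowConst N v m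

/-- The coefficients of the monomial expansion of `Z_v`, indexed by `Unit ⊕ (ℤ × ℕ) ⊕ (ℤ × ℕ)`
(constant term; the pieces from `π cot(π w_m)`, `m ∈ ℤ`, `r ≥ 1`; the pieces from `π cot(π mτ)`,
`m ≠ 0`, `r ≥ 1`). [cite: DiamondShurman2005, §4.8] -/
def eisensteinOneDivCoeff (N : ℕ) (v : Fin 2 → ℤ) : Unit ⊕ (ℤ × ℕ) ⊕ (ℤ × ℕ) → ℂ
  | Sum.inl _ => eisensteinOneDivConst N v
  | Sum.inr (Sum.inl p) =>
      if v 0 - N * p.1 = 0 ∨ p.2 = 0 then 0 else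
        -(((v 0 - N * p.1).sign : ℤ) : ℂ) * (2 * π * I) *
          cexp (2 * π * I * (((v 0 - N * p.1).sign * p.2 * v 1 : ℤ) : ℂ) / N)
  | Sum.inr (Sum.inr p) => if p.1 = 0 ∨ p.2 = 0 then 0 else -((p.1.sign : ℤ) : ℂ) * (2 * π * I)

/-- The exponents (of `q_N = e^{2πiτ/N}`) of the monomial expansion of `Z_v`. [cite: DiamondShurman2005, §4.8] -/
def eisensteinOneDivExp (N : ℕ) (v : Fin 2 → ℤ) : Unit ⊕ (ℤ × ℕ) ⊕ (ℤ × ℕ) → ℕ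
  | Sum.inl _ => 0
  | Sum.inr (Sum.inl p) => p.2 * (v 0 - N * p.1).natAbs
  | Sum.inr (Sum.inr p) => p.2 * (N * p.1.natAbs)

variable {N : ℕ} [NeZero N]

/-! ### The row constants are finitely supported -/

omit [NeZero N] in
/-- `κ_m = 0` for `|m| > |c_v|` (there `c_m ≠ 0`, `m ≠ 0` and `sgn(c_m) = -sgn(m)`). [folklore] -/
theorem zetaRowConst_eq_zero_of_lt (v : Fin 2 → ℤ) {m : ℤ} (hm : |v 0| < |m|) (hN : N ≠ 0) :
    zetaRowConst N v m = 0 := by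
  have hN1 : (1 : ℤ) ≤ N := by exact_mod_cast Nat.one_le_iff_ne_zero.mpr hN
  have hm0 : m ≠ 0 := by
    rintro rfl
    exact not_lt.mpr (abs_nonneg (v 0)) (by simpa using hm)
  unfold zetaRowConst
  rcases lt_or_gt_of_ne hm0 with hneg | hpos
  · -- `m < 0`: `c_m > 0`
    have habs : |m| = -m := abs_of_neg hneg
    have hc : 0 < v 0 - N * m := by
      have h1 : (N : ℤ) * m ≤ m := by nlinarith
      have h2 : -|v 0| ≤ v 0 := neg_abs_le (v 0)
      omega
    rw [if_neg hc.ne', if_neg hm0, Int.sign_eq_one_of_pos hc, Int.sign_eq_neg_one_of_neg hneg]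
    push_cast
    ring
  · -- `m > 0`: `c_m < 0`
    have habs : |m| = m := abs_of_pos hpos
    have hc : v 0 - N * m < 0 := by
      have h1 : m ≤ (N : ℤ) * m := by nlinarith
      have h2 : v 0 ≤ |v 0| := le_abs_self (v 0)
      omega
    rw [if_neg hc.ne, if_neg hm0, Int.sign_eq_neg_one_of_neg hc, Int.sign_eq_one_of_pos hpos]
    push_cast
    ring

/-- The row constants are supported in `|m| ≤ |c_v|`, hence summable with sum a finite sum.
[folklore] -/
theorem hasSum_zetaRowConst (v : Fin 2 → ℤ) :
    HasSum (fun m : ℤ ↦ zetaRowConst N v m)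
      (∑ m ∈ Finset.Icc (-|v 0|) |v 0|, zetaRowConst N v m) := by
  refine hasSum_sum_of_ne_finset_zero fun m hm ↦ ?_
  refine zetaRowConst_eq_zero_of_lt v ?_ (NeZero.ne N)
  simp only [Finset.mem_Icc, not_and_or, not_le] at hm
  rcases hm with h | h
  · have : m < 0 := by have := abs_nonneg (v 0); omega
    rw [abs_of_neg this]; omega
  · have : 0 < m := by have := abs_nonneg (v 0); omega
    rw [abs_of_pos this]; omega

/-- The row constants are summable. [folklore] -/
theorem summable_zetaRowConst (v : Fin 2 → ℤ) : Summable fun m : ℤ ↦ zetaRowConst N v m :=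
  (hasSum_zetaRowConst v).summable

/-! ### Summability of the dominating family -/

/-- **The coefficients of the monomial expansion are absolutely summable against `x^{exponent}`
for every `0 ≤ x < 1`** (domination by `2π x^{|c_m|-1} x^r`, resp. `2π x^{N|m|-1} x^r`, plus the
constant). [cite: DiamondShurman2005, §4.8] -/
theorem summable_norm_eisensteinOneDivCoeff_mul_pow (v : Fin 2 → ℤ) {x : ℝ} (hx : 0 ≤ x)
    (hx1 : x < 1) :
    Summable fun i ↦ ‖eisensteinOneDivCoeff N v i‖ * x ^ eisensteinOneDivExp N v i := by
  have hN : N ≠ 0 := NeZero.ne N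
  have h2π : ‖(2 * π * I : ℂ)‖ = 2 * π := by
    rw [norm_mul, norm_mul, Complex.norm_ofNat, Complex.norm_real, Complex.norm_I, mul_one,
      Real.norm_of_nonneg Real.pi_pos.le]
  have hsign : ∀ k : ℤ, k ≠ 0 → ‖(((k.sign : ℤ)) : ℂ)‖ = 1 := by
    intro k hk
    rcases lt_or_gt_of_ne hk with h | h
    · rw [Int.sign_eq_neg_one_of_neg h]; simp
    · rw [Int.sign_eq_one_of_pos h]; simp
  refine Summable.sum _ ?_ (Summable.sum _ ?_ ?_)
  · exact (hasSum_fintype _).summable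
  · -- the `A`-pieces
    have hdom : Summable fun p : ℤ × ℕ ↦ x ^ ((v 0 - N * p.1).natAbs - 1) * x ^ p.2 :=
      (summable_pow_natAbs_sub hN (v 0) hx hx1).mul_of_nonneg (summable_geometric_of_lt_one hx hx1)
        (fun m ↦ pow_nonneg hx _) (fun r ↦ pow_nonneg hx _)
    refine Summable.of_nonneg_of_le (fun p ↦ mul_nonneg (norm_nonneg _) (pow_nonneg hx _))
      (fun p ↦ ?_) (hdom.mul_left (2 * π))
    rcases p with ⟨m, r⟩
    show ‖eisensteinOneDivCoeff N v (Sum.inr (Sum.inl (m, r)))‖ *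
        x ^ eisensteinOneDivExp N v (Sum.inr (Sum.inl (m, r))) ≤ _
    simp only [eisensteinOneDivCoeff, eisensteinOneDivExp]
    by_cases h0 : v 0 - N * m = 0 ∨ r = 0
    · rw [if_pos h0, norm_zero, zero_mul]
      exact mul_nonneg (by positivity) (mul_nonneg (pow_nonneg hx _) (pow_nonneg hx _))
    · rw [if_neg h0]
      push Not at h0
      have hr : 1 ≤ r := Nat.one_le_iff_ne_zero.mpr h0.2
      have he : 1 ≤ (v 0 - N * m).natAbs := Int.natAbs_pos.mpr h0.1
      rw [norm_mul, norm_mul, norm_neg, hsign _ h0.1, one_mul, h2π, Complex.norm_exp]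
      have hre : (2 * π * I * ((((v 0 - N * m).sign * r * v 1 : ℤ)) : ℂ) / N).re = 0 := by
        rw [Complex.div_natCast_re]
        simp
      rw [hre, Real.exp_zero, mul_one]
      gcongr
      exact pow_mul_le_pow_sub_one_mul_pow hx hx1.le hr he
  · -- the `B`-pieces
    have hdom : Summable fun p : ℤ × ℕ ↦ x ^ (((0 : ℤ) - N * p.1).natAbs - 1) * x ^ p.2 :=
      (summable_pow_natAbs_sub hN 0 hx hx1).mul_of_nonneg (summable_geometric_of_lt_one hx hx1)
        (fun m ↦ pow_nonneg hx _) (fun r ↦ pow_nonneg hx _)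
    refine Summable.of_nonneg_of_le (fun p ↦ mul_nonneg (norm_nonneg _) (pow_nonneg hx _))
      (fun p ↦ ?_) (hdom.mul_left (2 * π))
    rcases p with ⟨m, r⟩
    show ‖eisensteinOneDivCoeff N v (Sum.inr (Sum.inr (m, r)))‖ *
        x ^ eisensteinOneDivExp N v (Sum.inr (Sum.inr (m, r))) ≤ _
    simp only [eisensteinOneDivCoeff, eisensteinOneDivExp]
    by_cases h0 : m = 0 ∨ r = 0
    · rw [if_pos h0, norm_zero, zero_mul]
      exact mul_nonneg (by positivity) (mul_nonneg (pow_nonneg hx _) (pow_nonneg hx _))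
    · rw [if_neg h0]
      push Not at h0
      have hr : 1 ≤ r := Nat.one_le_iff_ne_zero.mpr h0.2
      have he : 1 ≤ N * m.natAbs := Nat.one_le_iff_ne_zero.mpr
        (Nat.mul_ne_zero hN (Int.natAbs_ne_zero.mpr h0.1))
      have habs : ((0 : ℤ) - N * m).natAbs = N * m.natAbs := by
        rw [zero_sub, Int.natAbs_neg, Int.natAbs_mul, Int.natAbs_natCast]
      rw [norm_mul, norm_neg, hsign _ h0.1, one_mul, h2π, habs]
      gcongr
      exact pow_mul_le_pow_sub_one_mul_pow hx hx1.le hr he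

/-! ### `q`-expansions of the cotangents -/

omit [NeZero N] in
/-- `cot` is odd. [folklore] -/
theorem cot_neg' (x : ℂ) : Complex.cot (-x) = -Complex.cot x := by
  simp only [Complex.cot, Complex.cos_neg, Complex.sin_neg, div_neg]

omit [NeZero N] in
/-- **`∑_{r ≥ 1} (-2πi) e^{2πirw} = π cot(πw) + πi`** for `Im w > 0` (Mathlib `pi_mul_cot_pi_q_exp`
with the term `r = 0` removed). [folklore] -/
theorem hasSum_cot_of_im_pos {w : ℂ} (hw : 0 < w.im) :
    HasSum (fun r : ℕ ↦ if r = 0 then 0 else -(2 * π * I) * cexp (2 * π * I * w) ^ r)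
      (π * Complex.cot (π * w) + π * I) := by
  set z : ℍ := ⟨w, hw⟩ with hz
  have hzc : (z : ℂ) = w := rfl
  have hq : ‖cexp (2 * π * I * w)‖ < 1 := by
    rw [← hzc]; exact UpperHalfPlane.norm_exp_two_pi_I_lt_one z
  have hgeom := hasSum_geometric_of_norm_lt_one hq
  have hcot := pi_mul_cot_pi_q_exp z
  rw [hzc, hgeom.tsum_eq] at hcot
  have h1 := ((hasSum_nat_add_iff' 1).mpr hgeom).mul_left (-(2 * π * I))
  simp only [Finset.range_one, Finset.sum_singleton, pow_zero] at h1
  have hval : -(2 * π * I) * ((1 - cexp (2 * π * I * w))⁻¹ - 1) =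
      π * Complex.cot (π * w) + π * I := by
    rw [hcot]
    ring
  rw [hval] at h1
  rw [← hasSum_nat_add_iff' 1]
  simp only [Finset.range_one, Finset.sum_singleton, if_true, sub_zero]
  refine h1.congr_fun fun r ↦ ?_
  have hr : r + 1 ≠ 0 := Nat.succ_ne_zero r
  rw [if_neg hr]

omit [NeZero N] in
/-- **`∑_{r ≥ 1} 2πi e^{-2πirw} = π cot(πw) - πi`** for `Im w < 0` (the odd symmetry). [folklore] -/
theorem hasSum_cot_of_im_neg {w : ℂ} (hw : w.im < 0) :
    HasSum (fun r : ℕ ↦ if r = 0 then 0 else (2 * π * I) * cexp (2 * π * I * (-w)) ^ r)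
      (π * Complex.cot (π * w) - π * I) := by
  have hw' : 0 < (-w).im := by simp only [neg_im]; linarith
  have h := (hasSum_cot_of_im_pos hw').neg
  have hval : -(π * Complex.cot (π * -w) + π * I) = π * Complex.cot (π * w) - π * I := by
    rw [mul_neg, cot_neg']
    ring
  rw [hval] at h
  refine h.congr_fun fun r ↦ ?_
  by_cases hr : r = 0 <;> simp [hr]

/-! ### The pieces of a row sum to their monomials -/

/-- The `A`-piece of the row `m`: `[c_m ≠ 0] (π cot(π w_m) + sgn(c_m) πi)`. [folklore] -/
theorem hasSum_eisensteinOneDivCoeff_A (v : Fin 2 → ℤ) (τ : ℍ) (m : ℤ) :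
    HasSum (fun r : ℕ ↦ eisensteinOneDivCoeff N v (Sum.inr (Sum.inl (m, r))) *
        Periodic.qParam N τ ^ eisensteinOneDivExp N v (Sum.inr (Sum.inl (m, r))))
      (if v 0 - N * m = 0 then 0 else
        π * Complex.cot (π * divPoint N ![v 0 - N * m, v 1] τ) +
          (((v 0 - N * m).sign : ℤ) : ℂ) * (π * I)) := by
  have hN0 : (N : ℂ) ≠ 0 := by exact_mod_cast NeZero.ne N
  have hNpos : 0 < N := NeZero.pos N
  rcases lt_trichotomy (v 0 - N * m) 0 with hc | hc | hc
  · -- `c < 0`: `w_m = -w'` with `w' = (eτ - d_v)/N ∈ ℍ`, `e = -c`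
    rw [if_neg hc.ne]
    obtain ⟨e, he⟩ : ∃ e : ℕ, ((-(v 0 - N * m) : ℤ)) = e := ⟨(v 0 - N * m).natAbs, by omega⟩
    have he1 : 1 ≤ e := by omega
    set w' : ℂ := (((e : ℂ) * τ + ((-(v 1) : ℤ) : ℂ)) / N) with hw'
    have hw'pos : 0 < w'.im := by
      have := im_div_pos (N := N) (show (0 : ℤ) < (e : ℤ) by omega) (-(v 1)) τ hNpos
      simpa [hw'] using this
    have hwm : divPoint N ![v 0 - N * m, v 1] τ = -w' := by
      unfold divPoint
      simp only [Matrix.cons_val_zero, Matrix.cons_val_one, Matrix.cons_val_fin_one]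
      have hcast : (((v 0 - N * m : ℤ)) : ℂ) = -(e : ℂ) := by
        have : (v 0 - N * m : ℤ) = -(e : ℤ) := by omega
        exact_mod_cast this
      rw [hcast, hw']
      push_cast
      field_simp
      ring
    have hneg : (-w').im < 0 := by simp; exact hw'pos
    have hs := hasSum_cot_of_im_neg hneg
    rw [neg_neg] at hs
    rw [hwm]
    have hsign : (v 0 - N * m).sign = -1 := Int.sign_eq_neg_one_of_neg hc
    rw [hsign]
    push_cast
    rw [show π * Complex.cot (π * -w') + -1 * (π * I) = π * Complex.cot (π * -w') - π * I by ring]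
    refine hs.congr_fun fun r ↦ ?_
    have habs : (v 0 - N * m).natAbs = e := by omega
    simp only [eisensteinOneDivCoeff, eisensteinOneDivExp, hc.ne, false_or, habs, hsign]
    by_cases hr : r = 0
    · simp [hr]
    · rw [if_neg hr, if_neg hr, hw', cexp_two_pi_I_linear_div_pow]
      push_cast
      ring_nf
  · -- `c = 0`
    rw [if_pos hc]
    refine hasSum_zero.congr_fun fun r ↦ ?_
    simp [eisensteinOneDivCoeff, hc]
  · -- `c > 0`: `w_m = (eτ + d_v)/N ∈ ℍ`
    rw [if_neg hc.ne']
    obtain ⟨e, he⟩ : ∃ e : ℕ, (v 0 - N * m : ℤ) = e := ⟨(v 0 - N * m).natAbs, by omega⟩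
    have he1 : 1 ≤ e := by omega
    have hwm : divPoint N ![v 0 - N * m, v 1] τ = ((e : ℂ) * τ + ((v 1 : ℤ) : ℂ)) / N := by
      unfold divPoint
      simp only [Matrix.cons_val_zero, Matrix.cons_val_one, Matrix.cons_val_fin_one]
      have hcast : (((v 0 - N * m : ℤ)) : ℂ) = (e : ℂ) := by exact_mod_cast he
      rw [hcast]
    have hwpos : 0 < (((e : ℂ) * τ + ((v 1 : ℤ) : ℂ)) / N).im := by
      have := im_div_pos (N := N) (show (0 : ℤ) < (e : ℤ) by omega) (v 1) τ hNpos
      simpa using this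
    have hs := hasSum_cot_of_im_pos hwpos
    rw [hwm]
    have hsign : (v 0 - N * m).sign = 1 := Int.sign_eq_one_of_pos hc
    rw [hsign]
    push_cast
    rw [one_mul]
    refine hs.congr_fun fun r ↦ ?_
    have habs : (v 0 - N * m).natAbs = e := by omega
    simp only [eisensteinOneDivCoeff, eisensteinOneDivExp, hc.ne', false_or, habs, hsign]
    by_cases hr : r = 0
    · simp [hr]
    · rw [if_neg hr, if_neg hr, cexp_two_pi_I_linear_div_pow]
      push_cast
      ring_nf

omit [NeZero N] in
/-- `(⟨mτ, _⟩ : ℍ)`-free form of `pi_mul_cot_pi_q_exp` inputs: `Im(mτ) > 0` for `m > 0`. [folklore] -/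
theorem im_intCast_mul_pos {m : ℤ} (hm : 0 < m) (τ : ℍ) : 0 < ((m : ℂ) * τ).im := by
  simp only [mul_im, intCast_re, intCast_im, zero_mul, add_zero, UpperHalfPlane.coe_im]
  exact mul_pos (Int.cast_pos.mpr hm) τ.im_pos

/-- The `B`-piece of the row `m`: `[m ≠ 0] (π cot(π mτ) + sgn(m) πi)`. [folklore] -/
theorem hasSum_eisensteinOneDivCoeff_B (v : Fin 2 → ℤ) (τ : ℍ) (m : ℤ) :
    HasSum (fun r : ℕ ↦ eisensteinOneDivCoeff N v (Sum.inr (Sum.inr (m, r))) *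
        Periodic.qParam N τ ^ eisensteinOneDivExp N v (Sum.inr (Sum.inr (m, r))))
      (if m = 0 then 0 else π * Complex.cot (π * ((m : ℂ) * τ)) + ((m.sign : ℤ) : ℂ) * (π * I)) := by
  by_cases hm : m = 0
  · rw [if_pos hm]
    refine hasSum_zero.congr_fun fun r ↦ ?_
    simp [eisensteinOneDivCoeff, hm]
  rw [if_neg hm]
  obtain ⟨k, hk, hmk⟩ : ∃ k : ℕ, 0 < k ∧ (m = k ∨ m = -k) :=
    ⟨m.natAbs, Int.natAbs_pos.mpr hm, Int.natAbs_eq m⟩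
  have hnat : m.natAbs = k := by omega
  have hkpos : (0 : ℤ) < (k : ℤ) := by exact_mod_cast hk
  have hQdef : cexp (2 * π * I * (((k : ℤ) : ℂ) * τ)) = Periodic.qParam N τ ^ (N * k) := by
    rw [Int.cast_natCast]
    exact cexp_two_pi_I_natCast_mul (NeZero.ne N) k τ
  rcases hmk with hmk | hmk
  · -- `m = k > 0`
    have hs := hasSum_cot_of_im_pos (im_intCast_mul_pos hkpos τ)
    rw [hQdef] at hs
    have hsign : m.sign = 1 := by rw [hmk]; exact Int.sign_eq_one_of_pos hkpos
    have hval : π * Complex.cot (π * ((m : ℂ) * τ)) + ((m.sign : ℤ) : ℂ) * (π * I) =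
        π * Complex.cot (π * (((k : ℤ) : ℂ) * τ)) + π * I := by
      rw [hsign, hmk]
      push_cast
      ring
    rw [hval]
    refine hs.congr_fun fun r ↦ ?_
    simp only [eisensteinOneDivCoeff, eisensteinOneDivExp, hm, false_or, hnat, hsign]
    by_cases hr : r = 0
    · simp [hr]
    · rw [if_neg hr, if_neg hr, ← pow_mul, mul_comm (N * k) r]
      push_cast
      ring
  · -- `m = -k < 0`
    have hneg : ((m : ℂ) * τ).im < 0 := by
      have := im_intCast_mul_pos hkpos τ
      rw [hmk]
      push_cast at this ⊢
      simp only [neg_mul, neg_im]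
      linarith
    have hs := hasSum_cot_of_im_neg hneg
    have hmk' : -((m : ℂ) * τ) = ((k : ℤ) : ℂ) * τ := by rw [hmk]; push_cast; ring
    rw [hmk', hQdef] at hs
    have hsign : m.sign = -1 := by
      rw [hmk]; exact Int.sign_eq_neg_one_of_neg (by omega)
    have hval : π * Complex.cot (π * ((m : ℂ) * τ)) + ((m.sign : ℤ) : ℂ) * (π * I) =
        π * Complex.cot (π * ((m : ℂ) * τ)) - π * I := by
      rw [hsign]
      push_cast
      ring
    rw [hval]
    refine hs.congr_fun fun r ↦ ?_
    simp only [eisensteinOneDivCoeff, eisensteinOneDivExp, hm, false_or, hnat, hsign]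
    by_cases hr : r = 0
    · simp [hr]
    · rw [if_neg hr, if_neg hr, ← pow_mul, mul_comm (N * k) r]
      push_cast
      ring

/-! ### The decomposition `Z_v = C_v + ∑ A + ∑ B` -/

/-- The rows `m ↦ A_m(τ)` are summable. [folklore] -/
theorem summable_eisensteinOneDiv_A (v : Fin 2 → ℤ) (τ : ℍ) :
    Summable fun m : ℤ ↦ (if v 0 - N * m = 0 then 0 else
        π * Complex.cot (π * divPoint N ![v 0 - N * m, v 1] τ) +
          (((v 0 - N * m).sign : ℤ) : ℂ) * (π * I)) := by
  have hq0 : 0 ≤ ‖Periodic.qParam N τ‖ := norm_nonneg _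
  have hq : ‖Periodic.qParam N τ‖ < 1 :=
    Periodic.norm_qParam_lt_one (Nat.cast_pos.mpr (NeZero.pos N)) τ.im_pos
  have hS := ((summable_norm_eisensteinOneDivCoeff_mul_pow (N := N) v hq0 hq).comp_injective
    Sum.inr_injective).comp_injective Sum.inl_injective
  have hS' : Summable fun p : ℤ × ℕ ↦ eisensteinOneDivCoeff N v (Sum.inr (Sum.inl p)) *
      Periodic.qParam N τ ^ eisensteinOneDivExp N v (Sum.inr (Sum.inl p)) :=
    Summable.of_norm (hS.congr fun p ↦ by simp [norm_pow])
  refine hS'.prod.congr fun m ↦ ?_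
  exact (hasSum_eisensteinOneDivCoeff_A v τ m).tsum_eq

/-- The rows `m ↦ B_m(τ)` are summable (the statement does not involve the level; the proof goes
through the level-`N` monomial family). [folklore] -/
theorem summable_eisensteinOneDiv_B (N : ℕ) [NeZero N] (v : Fin 2 → ℤ) (τ : ℍ) :
    Summable fun m : ℤ ↦ (if m = 0 then 0 else
        π * Complex.cot (π * ((m : ℂ) * τ)) + ((m.sign : ℤ) : ℂ) * (π * I)) := by
  have hq0 : 0 ≤ ‖Periodic.qParam N τ‖ := norm_nonneg _
  have hq : ‖Periodic.qParam N τ‖ < 1 :=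
    Periodic.norm_qParam_lt_one (Nat.cast_pos.mpr (NeZero.pos N)) τ.im_pos
  have hS := ((summable_norm_eisensteinOneDivCoeff_mul_pow (N := N) v hq0 hq).comp_injective
    Sum.inr_injective).comp_injective Sum.inr_injective
  have hS' : Summable fun p : ℤ × ℕ ↦ eisensteinOneDivCoeff N v (Sum.inr (Sum.inr p)) *
      Periodic.qParam N τ ^ eisensteinOneDivExp N v (Sum.inr (Sum.inr p)) :=
    Summable.of_norm (hS.congr fun p ↦ by simp [norm_pow])
  refine hS'.prod.congr fun m ↦ ?_
  exact (hasSum_eisensteinOneDivCoeff_B (N := N) v τ m).tsum_eq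

/-- **`T_m = κ_m + A_m + B_m`**: each pair row is its constant plus its two `q`-tails.
[folklore] -/
theorem zetaRow_eq_const_add (v : Fin 2 → ℤ) (τ : ℍ) (m : ℤ)
    (hv : ¬ ((N : ℤ) ∣ v 0 ∧ (N : ℤ) ∣ v 1)) :
    zetaRow N v τ m = zetaRowConst N v m +
      ((if v 0 - N * m = 0 then 0 else
          π * Complex.cot (π * divPoint N ![v 0 - N * m, v 1] τ) +
            (((v 0 - N * m).sign : ℤ) : ℂ) * (π * I)) +
        (if m = 0 then 0 else
          π * Complex.cot (π * ((m : ℂ) * τ)) + ((m.sign : ℤ) : ℂ) * (π * I))) := by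
  rw [zetaRow_eq_cot v τ m hv, zetaRowConst]
  by_cases hc : v 0 - N * m = 0
  · have hw : divPoint N ![v 0 - N * m, v 1] τ = (v 1 : ℂ) / N := by
      unfold divPoint
      simp [hc]
    rw [hw, if_pos hc, if_pos hc]
    by_cases hm : m = 0
    · simp [hm]
    · rw [if_neg hm, if_neg hm, if_neg hm]
      ring
  · rw [if_neg hc, if_neg hc]
    by_cases hm : m = 0
    · simp [hm]
    · rw [if_neg hm, if_neg hm, if_neg hm]
      ring

/-- **`Z_v = C_v + ∑_m A_m + ∑_m B_m`** for `v ≢ 0 (mod N)`; all three `m`-series converge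
absolutely. [cite: DiamondShurman2005, §4.8] -/
theorem eisensteinOneDiv_eq_const_add_tsum (v : Fin 2 → ℤ) (τ : ℍ)
    (hv : ¬ ((N : ℤ) ∣ v 0 ∧ (N : ℤ) ∣ v 1)) :
    eisensteinOneDiv N v τ = eisensteinOneDivConst N v +
      ((∑' m : ℤ, (if v 0 - N * m = 0 then 0 else
          π * Complex.cot (π * divPoint N ![v 0 - N * m, v 1] τ) +
            (((v 0 - N * m).sign : ℤ) : ℂ) * (π * I))) +
        ∑' m : ℤ, (if m = 0 then 0 else
          π * Complex.cot (π * ((m : ℂ) * τ)) + ((m.sign : ℤ) : ℂ) * (π * I))) := by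
  have hrows := hasSum_zetaRow_eisensteinOneDiv (N := N) v τ
  have hdec : HasSum (fun m : ℤ ↦ zetaRow N v τ m)
      ((∑' m : ℤ, zetaRowConst N v m) +
        ((∑' m : ℤ, (if v 0 - N * m = 0 then 0 else
            π * Complex.cot (π * divPoint N ![v 0 - N * m, v 1] τ) +
              (((v 0 - N * m).sign : ℤ) : ℂ) * (π * I))) +
          ∑' m : ℤ, (if m = 0 then 0 else
            π * Complex.cot (π * ((m : ℂ) * τ)) + ((m.sign : ℤ) : ℂ) * (π * I)))) := by
    have h := (summable_zetaRowConst (N := N) v).hasSum.add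
      ((summable_eisensteinOneDiv_A (N := N) v τ).hasSum.add (summable_eisensteinOneDiv_B N v τ).hasSum)
    refine h.congr_fun fun m ↦ ?_
    exact zetaRow_eq_const_add v τ m hv
  have huniq := hrows.unique hdec
  rw [eisensteinOneDivConst, if_neg hv]
  linear_combination huniq

/-- **The monomial expansion of `Z_v`** (`v ≢ 0 (mod N)`): the absolutely summable family of
monomials `coeff(i) q_N^{exp(i)}` sums to `Z_v(τ)`. [cite: DiamondShurman2005, §4.8] -/
theorem hasSum_eisensteinOneDiv_monomials (v : Fin 2 → ℤ) (τ : ℍ)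
    (hv : ¬ ((N : ℤ) ∣ v 0 ∧ (N : ℤ) ∣ v 1)) :
    HasSum (fun i ↦ eisensteinOneDivCoeff N v i * Periodic.qParam N τ ^ eisensteinOneDivExp N v i)
      (eisensteinOneDiv N v τ) := by
  have hq0 : 0 ≤ ‖Periodic.qParam N τ‖ := norm_nonneg _
  have hq : ‖Periodic.qParam N τ‖ < 1 :=
    Periodic.norm_qParam_lt_one (Nat.cast_pos.mpr (NeZero.pos N)) τ.im_pos
  have hall : Summable fun i ↦ eisensteinOneDivCoeff N v i *
      Periodic.qParam N τ ^ eisensteinOneDivExp N v i :=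
    Summable.of_norm ((summable_norm_eisensteinOneDivCoeff_mul_pow (N := N) v hq0 hq).congr
      fun i ↦ by simp [norm_pow])
  set SA : ℂ := ∑' m : ℤ, (if v 0 - N * m = 0 then 0 else
      π * Complex.cot (π * divPoint N ![v 0 - N * m, v 1] τ) +
        (((v 0 - N * m).sign : ℤ) : ℂ) * (π * I)) with hSA
  set SB : ℂ := ∑' m : ℤ, (if m = 0 then 0 else
      π * Complex.cot (π * ((m : ℂ) * τ)) + ((m.sign : ℤ) : ℂ) * (π * I)) with hSB
  have hA : HasSum (fun p : ℤ × ℕ ↦ eisensteinOneDivCoeff N v (Sum.inr (Sum.inl p)) *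
      Periodic.qParam N τ ^ eisensteinOneDivExp N v (Sum.inr (Sum.inl p))) SA := by
    have hs : Summable fun p : ℤ × ℕ ↦ eisensteinOneDivCoeff N v (Sum.inr (Sum.inl p)) *
        Periodic.qParam N τ ^ eisensteinOneDivExp N v (Sum.inr (Sum.inl p)) :=
      (hall.comp_injective Sum.inr_injective).comp_injective Sum.inl_injective
    have h := hs.hasSum
    rw [hs.tsum_prod] at h
    have heq : ∑' (m : ℤ) (r : ℕ), eisensteinOneDivCoeff N v (Sum.inr (Sum.inl (m, r))) *
        Periodic.qParam N τ ^ eisensteinOneDivExp N v (Sum.inr (Sum.inl (m, r))) = SA :=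
      tsum_congr fun m ↦ (hasSum_eisensteinOneDivCoeff_A v τ m).tsum_eq
    rwa [heq] at h
  have hB : HasSum (fun p : ℤ × ℕ ↦ eisensteinOneDivCoeff N v (Sum.inr (Sum.inr p)) *
      Periodic.qParam N τ ^ eisensteinOneDivExp N v (Sum.inr (Sum.inr p))) SB := by
    have hs : Summable fun p : ℤ × ℕ ↦ eisensteinOneDivCoeff N v (Sum.inr (Sum.inr p)) *
        Periodic.qParam N τ ^ eisensteinOneDivExp N v (Sum.inr (Sum.inr p)) :=
      (hall.comp_injective Sum.inr_injective).comp_injective Sum.inr_injective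
    have h := hs.hasSum
    rw [hs.tsum_prod] at h
    have heq : ∑' (m : ℤ) (r : ℕ), eisensteinOneDivCoeff N v (Sum.inr (Sum.inr (m, r))) *
        Periodic.qParam N τ ^ eisensteinOneDivExp N v (Sum.inr (Sum.inr (m, r))) = SB :=
      tsum_congr fun m ↦ (hasSum_eisensteinOneDivCoeff_B (N := N) v τ m).tsum_eq
    rwa [heq] at h
  have hC : HasSum (fun u : Unit ↦ eisensteinOneDivCoeff N v (Sum.inl u) *
      Periodic.qParam N τ ^ eisensteinOneDivExp N v (Sum.inl u)) (eisensteinOneDivConst N v) := by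
    have h := hasSum_fintype (fun _ : Unit ↦ eisensteinOneDivConst N v)
    simp only [Finset.univ_unique, Finset.sum_singleton] at h
    refine h.congr_fun fun u ↦ ?_
    simp only [eisensteinOneDivCoeff, eisensteinOneDivExp, pow_zero, mul_one]
  have htot : HasSum (fun i ↦ eisensteinOneDivCoeff N v i *
      Periodic.qParam N τ ^ eisensteinOneDivExp N v i)
      (eisensteinOneDivConst N v + (SA + SB)) := HasSum.sum hC (HasSum.sum hA hB)
  rwa [← eisensteinOneDiv_eq_const_add_tsum v τ hv] at htot

/-! ### The degenerate vectors `v ≡ 0 (mod N)` -/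

omit [NeZero N] in
/-- `Z_0 = 0` (every term of the lattice sum vanishes: `N/(-N l) + 1/l = 0`, `z_0 = 0`).
[folklore] -/
theorem eisensteinOneDiv_zero (hN : N ≠ 0) (τ : ℍ) : eisensteinOneDiv N 0 τ = 0 := by
  have hN' : (N : ℂ) ≠ 0 := by exact_mod_cast hN
  have hdiv : divPoint N 0 τ = 0 := by simp [divPoint]
  have hterm : ∀ x : Fin 2 → ℤ, zetaDivSummand N 0 τ x = 0 := by
    intro x
    unfold zetaDivSummand
    rw [hdiv, zero_mul, add_zero, zero_sub]
    have h0 : ((-((N : ℤ) • x)) 0 : ℤ) = -(N * x 0) := by simp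
    have h1 : ((-((N : ℤ) • x)) 1 : ℤ) = -(N * x 1) := by simp
    simp only [eisSummand, h0, h1]
    push_cast
    rw [show -((N : ℂ) * (x 0 : ℂ)) * (τ : ℂ) + -((N : ℂ) * (x 1 : ℂ)) =
      -(N : ℂ) * ((x 0 : ℂ) * τ + x 1) by ring, mul_zpow, _root_.zpow_neg_one, _root_.zpow_neg_one]
    rw [← mul_assoc, show (N : ℂ) * (-(N : ℂ))⁻¹ = -1 by
      rw [inv_neg, mul_neg, mul_inv_cancel₀ hN']]
    ring
  unfold eisensteinOneDiv weierstrassZetaDiv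
  simp only [hterm, tsum_zero, hdiv, Pi.zero_apply, Int.cast_zero]
  simp

/-- `Z_v = 0` for `v ≡ 0 (mod N)`. [folklore] -/
theorem eisensteinOneDiv_eq_zero_of_dvd (v : Fin 2 → ℤ) (τ : ℍ)
    (hv : (N : ℤ) ∣ v 0 ∧ (N : ℤ) ∣ v 1) : eisensteinOneDiv N v τ = 0 := by
  have h : eisensteinOneDiv N v τ = eisensteinOneDiv N 0 τ := by
    refine eisensteinOneDiv_congr_mod (NeZero.ne N) (fun i ↦ ?_) τ
    fin_cases i
    · simpa using (ZMod.intCast_zmod_eq_zero_iff_dvd _ _).mpr hv.1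
    · simpa using (ZMod.intCast_zmod_eq_zero_iff_dvd _ _).mpr hv.2
  rw [h, eisensteinOneDiv_zero (NeZero.ne N)]

/-! ### Limit at `i∞`, boundedness, holomorphy -/

/-- Monomials with exponent `0` have coefficient `0`, except the constant term. [folklore] -/
theorem eisensteinOneDivCoeff_eq_zero_of_exp_eq_zero (v : Fin 2 → ℤ)
    (i : Unit ⊕ (ℤ × ℕ) ⊕ (ℤ × ℕ)) (hi : i ≠ Sum.inl ()) (h0 : eisensteinOneDivExp N v i = 0) :
    eisensteinOneDivCoeff N v i = 0 := by
  rcases i with u | ⟨m, r⟩ | ⟨m, r⟩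
  · exact absurd rfl hi
  · simp only [eisensteinOneDivExp, mul_eq_zero, Int.natAbs_eq_zero] at h0
    rcases h0 with rfl | hc
    · simp [eisensteinOneDivCoeff]
    · simp [eisensteinOneDivCoeff, hc]
  · simp only [eisensteinOneDivExp, mul_eq_zero, Int.natAbs_eq_zero, NeZero.ne N, false_or] at h0
    rcases h0 with rfl | hm
    · simp [eisensteinOneDivCoeff]
    · simp [eisensteinOneDivCoeff, hm]

/-- **`Z_v(τ) → C_v` as `Im τ → ∞`** (Tannery's theorem on the monomial expansion; `Z_v = 0 = C_v`
for `v ≡ 0`). [cite: DiamondShurman2005, §4.8] -/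
theorem tendsto_eisensteinOneDiv_atImInfty (v : Fin 2 → ℤ) :
    Tendsto (eisensteinOneDiv N v) atImInfty (𝓝 (eisensteinOneDivConst N v)) := by
  by_cases hv : (N : ℤ) ∣ v 0 ∧ (N : ℤ) ∣ v 1
  · have h0 : eisensteinOneDiv N v = fun _ ↦ 0 := funext fun τ ↦ eisensteinOneDiv_eq_zero_of_dvd v τ hv
    rw [h0, eisensteinOneDivConst, if_pos hv]
    exact tendsto_const_nhds
  have hNr : (0 : ℝ) < N := Nat.cast_pos.mpr (NeZero.pos N)
  set x₀ : ℝ := Real.exp (-2 * π * 1 / N) with hx₀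
  have hx0 : 0 ≤ x₀ := (Real.exp_pos _).le
  have hx1 : x₀ < 1 := by
    rw [hx₀, Real.exp_lt_one_iff]
    exact div_neg_of_neg_of_pos (by linarith [Real.pi_pos]) hNr
  have hbound := summable_norm_eisensteinOneDivCoeff_mul_pow (N := N) v hx0 hx1
  have hlim : ∀ i, Tendsto (fun τ : ℍ ↦ eisensteinOneDivCoeff N v i *
      Periodic.qParam N τ ^ eisensteinOneDivExp N v i) atImInfty
      (𝓝 (if eisensteinOneDivExp N v i = 0 then eisensteinOneDivCoeff N v i else 0)) := by
    intro i
    by_cases h : eisensteinOneDivExp N v i = 0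
    · simp only [h, pow_zero, mul_one, if_true]
      exact tendsto_const_nhds
    · rw [if_neg h]
      have := ((qParam_tendsto_atImInfty hNr).pow (eisensteinOneDivExp N v i)).const_mul
        (eisensteinOneDivCoeff N v i)
      simpa [zero_pow h] using this
  have hev : ∀ᶠ τ : ℍ in atImInfty, ∀ i, ‖eisensteinOneDivCoeff N v i *
      Periodic.qParam N τ ^ eisensteinOneDivExp N v i‖ ≤
        ‖eisensteinOneDivCoeff N v i‖ * x₀ ^ eisensteinOneDivExp N v i := by
    rw [Filter.Eventually, atImInfty_mem]
    refine ⟨1, fun τ hτ i ↦ ?_⟩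
    rw [norm_mul, norm_pow]
    gcongr
    rw [Periodic.norm_qParam, hx₀, Real.exp_le_exp, UpperHalfPlane.coe_im]
    exact div_le_div_of_nonneg_right (by nlinarith [Real.pi_pos]) hNr.le
  have h := tendsto_tsum_of_dominated_convergence hbound hlim hev
  have hL : (fun τ : ℍ ↦ ∑' i, eisensteinOneDivCoeff N v i *
      Periodic.qParam N τ ^ eisensteinOneDivExp N v i) = eisensteinOneDiv N v :=
    funext fun τ ↦ (hasSum_eisensteinOneDiv_monomials v τ hv).tsum_eq
  have hR : ∑' i, (if eisensteinOneDivExp N v i = 0 then eisensteinOneDivCoeff N v i else 0) =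
      eisensteinOneDivConst N v := by
    rw [tsum_eq_single (Sum.inl ())]
    · simp [eisensteinOneDivExp, eisensteinOneDivCoeff]
    · intro i hi
      by_cases h0 : eisensteinOneDivExp N v i = 0
      · rw [if_pos h0, eisensteinOneDivCoeff_eq_zero_of_exp_eq_zero v i hi h0]
      · rw [if_neg h0]
  rwa [hL, hR] at h

/-- **Every corrected `ζ`-division value `Z_v` is bounded at `i∞`.** [cite: DiamondShurman2005, §4.8] -/
theorem isBoundedAtImInfty_eisensteinOneDiv (v : Fin 2 → ℤ) :
    IsBoundedAtImInfty (eisensteinOneDiv N v) :=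
  (tendsto_eisensteinOneDiv_atImInfty v).isBigO_one ℝ

/-- **Every corrected `ζ`-division value `Z_v` is holomorphic on `ℍ`** (locally uniform convergence
of the monomial expansion on half-planes `Im τ > y₀ > 0`; `Z_v = 0` for `v ≡ 0`).
[cite: DiamondShurman2005, §4.8] -/
theorem mdifferentiable_eisensteinOneDiv (v : Fin 2 → ℤ) :
    MDifferentiable 𝓘(ℂ) 𝓘(ℂ) (eisensteinOneDiv N v) := by
  by_cases hv : (N : ℤ) ∣ v 0 ∧ (N : ℤ) ∣ v 1
  · have h0 : eisensteinOneDiv N v = fun _ ↦ 0 := funext fun τ ↦ eisensteinOneDiv_eq_zero_of_dvd v τ hv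
    rw [h0]
    exact mdifferentiable_const
  have hNr : (0 : ℝ) < N := Nat.cast_pos.mpr (NeZero.pos N)
  rw [UpperHalfPlane.mdifferentiable_iff]
  intro z hz
  have hz' : 0 < z.im := hz
  set y₀ : ℝ := z.im / 2 with hy₀
  have hy₀pos : 0 < y₀ := by positivity
  have hU : IsOpen {w : ℂ | y₀ < w.im} := isOpen_lt continuous_const Complex.continuous_im
  have hzU : z ∈ {w : ℂ | y₀ < w.im} := by
    show y₀ < z.im
    rw [hy₀]
    linarith
  set x₀ : ℝ := Real.exp (-2 * π * y₀ / N) with hx₀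
  have hx0 : 0 ≤ x₀ := (Real.exp_pos _).le
  have hx1 : x₀ < 1 := by
    rw [hx₀, Real.exp_lt_one_iff]
    exact div_neg_of_neg_of_pos (by nlinarith [Real.pi_pos]) hNr
  have hbound := summable_norm_eisensteinOneDivCoeff_mul_pow (N := N) v hx0 hx1
  have hdiff : DifferentiableOn ℂ (fun w : ℂ ↦ ∑' i, eisensteinOneDivCoeff N v i *
      Periodic.qParam N w ^ eisensteinOneDivExp N v i) {w : ℂ | y₀ < w.im} := by
    refine differentiableOn_tsum_of_summable_norm hbound (fun i ↦ ?_) hU (fun i w hw ↦ ?_)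
    · exact ((differentiable_const _).mul
        ((Periodic.differentiable_qParam (h := N)).pow _)).differentiableOn
    · rw [norm_mul, norm_pow]
      gcongr
      rw [Periodic.norm_qParam, hx₀, Real.exp_le_exp]
      have hw' : y₀ ≤ w.im := le_of_lt hw
      exact div_le_div_of_nonneg_right (by nlinarith [Real.pi_pos]) hNr.le
  have heq : Set.EqOn (eisensteinOneDiv N v ∘ ofComplex) (fun w : ℂ ↦ ∑' i,
      eisensteinOneDivCoeff N v i * Periodic.qParam N w ^ eisensteinOneDivExp N v i)
      {w : ℂ | y₀ < w.im} := by
    intro w hw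
    have hw0 : 0 < w.im := lt_trans hy₀pos hw
    simp only [Function.comp_apply, ofComplex_apply_of_im_pos hw0]
    exact ((hasSum_eisensteinOneDiv_monomials v ⟨w, hw0⟩ hv).tsum_eq).symm
  exact ((hdiff.congr heq).differentiableAt (hU.mem_nhds hzU)).differentiableWithinAt

/-- `Z_v` is continuous. [folklore] -/
theorem continuous_eisensteinOneDiv (v : Fin 2 → ℤ) : Continuous (eisensteinOneDiv N v) :=
  (mdifferentiable_eisensteinOneDiv v).continuous

/-! ### The value of the constant term -/

/-- **`C_{v + Nw} = C_v`** (uniqueness of the limit of `Z_{v+Nw} = Z_v` at `i∞`). [folklore] -/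
theorem eisensteinOneDivConst_add_nsmul (v w : Fin 2 → ℤ) :
    eisensteinOneDivConst N (v + (N : ℤ) • w) = eisensteinOneDivConst N v := by
  have h1 := tendsto_eisensteinOneDiv_atImInfty (N := N) (v + (N : ℤ) • w)
  have h2 := tendsto_eisensteinOneDiv_atImInfty (N := N) v
  have heq : eisensteinOneDiv N (v + (N : ℤ) • w) = eisensteinOneDiv N v :=
    funext fun τ ↦ eisensteinOneDiv_add_nsmul (NeZero.ne N) v w τ
  rw [heq] at h1
  exact tendsto_nhds_unique h1 h2

/-- `C_v` only depends on `v mod N`. [folklore] -/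
theorem eisensteinOneDivConst_congr_mod {v v' : Fin 2 → ℤ}
    (h : ∀ i, (v i : ZMod N) = (v' i : ZMod N)) :
    eisensteinOneDivConst N v = eisensteinOneDivConst N v' := by
  have hw : ∀ i, ∃ w : ℤ, v' i = v i + N * w := fun i ↦ by
    obtain ⟨w, hw⟩ := (ZMod.intCast_eq_intCast_iff_dvd_sub (v i) (v' i) N).1 (h i)
    exact ⟨w, by linarith⟩
  choose w hw using hw
  have : v' = v + (N : ℤ) • (fun i ↦ w i) := by
    funext i
    rw [Pi.add_apply, Pi.smul_apply, smul_eq_mul]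
    exact hw i
  rw [this, eisensteinOneDivConst_add_nsmul]

omit [NeZero N] in
/-- In the fundamental range `0 ≤ c_v < N` all row constants with `m ≠ 0` vanish. [folklore] -/
theorem zetaRowConst_eq_zero_of_range (v : Fin 2 → ℤ) (h0 : 0 ≤ v 0) (h1 : v 0 < N) {m : ℤ}
    (hm : m ≠ 0) : zetaRowConst N v m = 0 := by
  unfold zetaRowConst
  rcases lt_or_gt_of_ne hm with hneg | hpos
  · have hc : 0 < v 0 - N * m := by nlinarith
    rw [if_neg hc.ne', if_neg hm, Int.sign_eq_one_of_pos hc, Int.sign_eq_neg_one_of_neg hneg]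
    push_cast
    ring
  · have hc : v 0 - N * m < 0 := by nlinarith
    rw [if_neg hc.ne, if_neg hm, Int.sign_eq_neg_one_of_neg hc, Int.sign_eq_one_of_pos hpos]
    push_cast
    ring

/-- **`C_v = 2πi (c_v/N - 1/2) = 2πi B₁(c_v/N)`** for `0 < c_v < N`: the first Bernoulli function,
the constant term of the weight-one Eisenstein series `g_v` (Hecke 1927, (13); Diamond–Shurman
§4.8). [cite: DiamondShurman2005, §4.8] -/
theorem eisensteinOneDivConst_eq_of_pos_of_lt (v : Fin 2 → ℤ) (h0 : 0 < v 0) (h1 : v 0 < N) :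
    eisensteinOneDivConst N v = 2 * π * I * ((v 0 : ℂ) / N - 1 / 2) := by
  have hv : ¬ ((N : ℤ) ∣ v 0 ∧ (N : ℤ) ∣ v 1) := by
    rintro ⟨⟨k, hk⟩, -⟩
    have hNpos : (0 : ℤ) < N := by exact_mod_cast NeZero.pos N
    rcases le_or_gt k 0 with hk0 | hk0
    · have : (N : ℤ) * k ≤ 0 := mul_nonpos_of_nonneg_of_nonpos hNpos.le hk0
      omega
    · have : (N : ℤ) ≤ N * k := le_mul_of_one_le_right hNpos.le hk0
      omega
  rw [eisensteinOneDivConst, if_neg hv, tsum_eq_single 0 fun m hm ↦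
    zetaRowConst_eq_zero_of_range v h0.le h1 hm]
  have hκ : zetaRowConst N v 0 = -(π * I) := by
    unfold zetaRowConst
    rw [mul_zero, sub_zero, if_neg h0.ne', if_pos rfl, Int.sign_eq_one_of_pos h0]
    push_cast
    ring
  rw [hκ]
  ring

/-- **`C_v = π cot(π d_v/N)`** for `c_v = 0`, `N ∤ d_v` (the cotangent values whose character sums
are `L(1, ψ̄)`, i.e. Gauss sums times `B_{1,ψ}`). [cite: DiamondShurman2005, §4.8] -/
theorem eisensteinOneDivConst_eq_of_eq_zero (v : Fin 2 → ℤ) (h0 : v 0 = 0)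
    (h1 : ¬ (N : ℤ) ∣ v 1) :
    eisensteinOneDivConst N v = π * Complex.cot (π * ((v 1 : ℂ) / N)) := by
  have hv : ¬ ((N : ℤ) ∣ v 0 ∧ (N : ℤ) ∣ v 1) := fun h ↦ h1 h.2
  have hN : (0 : ℤ) < N := by exact_mod_cast NeZero.pos N
  rw [eisensteinOneDivConst, if_neg hv, tsum_eq_single 0 fun m hm ↦
    zetaRowConst_eq_zero_of_range v (le_of_eq h0.symm) (by rw [h0]; exact hN) hm]
  have hκ : zetaRowConst N v 0 = π * Complex.cot (π * ((v 1 : ℂ) / N)) := by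
    unfold zetaRowConst
    rw [mul_zero, sub_zero, if_pos h0, if_pos rfl, add_zero]
  rw [hκ, h0]
  simp

end Literature.NumberTheory.EllipticCurves.ModularForms
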